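import Summits.AtomisticToContinuum.Crystallization.Theorems.ChargedEnergyGapStabilityFibres
import HarnessLib

/-!
# Charged energy gap — lens-3 g62, part P-R: layer surpluses of Barlow words are non-negative (the seam ledger's row 0)

Cell `decomp-a2c`, seat lens-3, generation 62, part P-R (after P-Q `ChargedEnergyGapStabilityFibres`).  ELEMENTARY·PROVED, reduction-side
bookkeeping: the COMBINATORIAL half of the seam ledger's 0th-order row (memo g62 §1.2 / §1.3 (a)).  In the census's certified layer-pair language
(evidence-g34/SEAM62.md: `b_k := E_stag(k) − E_ecl(k)` per site at layer separation `k`, interval-certified at sharp cutoff 16), the rigid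
common-spacing energy of a layer `L` of an arbitrary close-packed stacking (a BARLOW WORD `w : ℤ → Fin 3`, adjacent letters distinct) exceeds that
of an hcp layer by `½ Σ_{sides} Σ_k registryTerm b w L (±k)`, where the REGISTRY TERM at separation `k` is `+b_k` if `k` is even and the pair
`(L, L ± k)` is staggered (letters differ; hcp is eclipsed there), `−b_k` if `k` is odd and the pair is eclipsed (letters equal; hcp is staggered there),
and `0` otherwise.  THE LEMMA (`registryPair_nonneg`, `wordSurplus_nonneg`): if every even `b_k` is `≥ 0` and every odd `b_k` that is positive is
dominated by its even predecessor (`b_k ≤ b_{k−1}`), then every layer of every Barlow word has surplus `≥ 0` — because «eclipsed at odd `k`» forces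
«staggered at `k − 1`» (`L + k` and `L` carry the same letter, so `L + k − 1` carries another).  The census table satisfies the hypotheses in all four
certified geometry columns (even `b_k > 0` for `k = 2 … 20`; positive odd ones only `b₅ ≤ b₄`, `b₁₃ ≤ b₁₂`, `b₁₇ ≤ b₁₆`, and `b₉ ≤ b₈` in the `a + 2·10⁻⁴`
column — `record_bk_dominance` pins the record column's three pairs as rationals enclosing the certified intervals).  Consequence (memo §1.3 (a)): the
«reference-stacking dipole» dip of the leaf is ZERO at the rigid level — no layer word is cheaper than hcp's.  `wordSurplus_hcp` : the hcp word itself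
has surplus `0` (every term vanishes).
-/

noncomputable section

open scoped Classical

open Literature.MathematicalPhysics.StatisticalMechanics Literature.Geometry.DiscreteGeometry
open Summit.AtomisticToContinuum.Crystallization.Theses.PricedLinkCensus
open Summit.AtomisticToContinuum.Crystallization.Theorems.ChargedEnergyGapNegative

namespace Summit.AtomisticToContinuum.Crystallization.Theorems.ChargedEnergyGapChartDial

section StackingWords

/-- A **BARLOW WORD**: a two-sided letter sequence over `{A, B, C} = Fin 3` with adjacent letters distinct (a close-packed stacking). -/
def IsBarlowWord (w : ℤ → Fin 3) : Prop :=
  ∀ i : ℤ, w i ≠ w (i + 1)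

/-- The **REGISTRY TERM** of the word `w` at layer `L`, signed separation `s`, absolute separation `k`, with layer-pair table `b`: relative to hcp
(eclipsed at even, staggered at odd separations) a staggered pair at even `k` costs `b k`, an eclipsed pair at odd `k` costs `−b k`, else `0`. -/
def registryTerm (b : ℕ → ℝ) (w : ℤ → Fin 3) (L s : ℤ) (k : ℕ) : ℝ :=
  if Even k then (if w (L + s) = w L then 0 else b k) else (if w (L + s) = w L then -(b k) else 0)

/-- The **ONE-SIDED LAYER SURPLUS** of `w` at layer `L` in direction `ε = ±1`, separations `2 … 2J+1` grouped in pairs `(2j+2, 2j+3)`: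
`Σ_{j < J} [registryTerm (k = 2j+2) + registryTerm (k = 2j+3)]` (separation `1` never contributes: adjacent layers are always staggered, as in hcp). -/
def wordSurplusSide (b : ℕ → ℝ) (w : ℤ → Fin 3) (L ε : ℤ) (J : ℕ) : ℝ :=
  ∑ j ∈ Finset.range J, (registryTerm b w L (ε * (2 * j + 2 : ℕ)) (2 * j + 2) + registryTerm b w L (ε * (2 * j + 3 : ℕ)) (2 * j + 3))

/-- The **LAYER SURPLUS** of `w` at `L` up to separation `2J+1`: both sides. (The census's per-site surplus over hcp is `½ ×` this with its `b_k`.) -/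
def wordSurplus (b : ℕ → ℝ) (w : ℤ → Fin 3) (L : ℤ) (J : ℕ) : ℝ :=
  wordSurplusSide b w L 1 J + wordSurplusSide b w L (-1) J

variable {b : ℕ → ℝ} {w : ℤ → Fin 3}

/-- In a Barlow word, «eclipsed at `L + s + ε`» (`ε = ±1`) forces «staggered at `L + s`»: equal letters at distance one apart from `L + s` differ from it. -/
theorem IsBarlowWord.ne_of_eq_succ (hw : IsBarlowWord w) {L s : ℤ} (h : w (L + (s + 1)) = w L) : w (L + s) ≠ w L := by
  intro h'
  have := hw (L + s)
  rw [h', show L + s + 1 = L + (s + 1) by ring, h] at this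
  exact this rfl

/-- `IsBarlowWord.ne_of_eq_pred` (docstring added by the landing lane; see the module docstring). [formal bookkeeping] -/
theorem IsBarlowWord.ne_of_eq_pred (hw : IsBarlowWord w) {L s : ℤ} (h : w (L + (s - 1)) = w L) : w (L + s) ≠ w L := by
  intro h'
  have := hw (L + (s - 1))
  rw [h, show L + (s - 1) + 1 = L + s by ring, h'] at this
  exact this rfl

/-- ★ **A REGISTRY PAIR IS NON-NEGATIVE**: for `ε = ±1`, the terms at separations `2j+2` (even) and `2j+3` (odd) of a Barlow word sum to `≥ 0`
whenever `0 ≤ b (2j+2)` and `0 < b (2j+3) → b (2j+3) ≤ b (2j+2)`. -/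
theorem registryPair_nonneg (hw : IsBarlowWord w) (L : ℤ) {ε : ℤ} (hε : ε = 1 ∨ ε = -1) (j : ℕ)
    (heven : 0 ≤ b (2 * j + 2)) (hodd : 0 < b (2 * j + 3) → b (2 * j + 3) ≤ b (2 * j + 2)) :
    0 ≤ registryTerm b w L (ε * (2 * j + 2 : ℕ)) (2 * j + 2) + registryTerm b w L (ε * (2 * j + 3 : ℕ)) (2 * j + 3) := by
  have he : Even (2 * j + 2) := ⟨j + 1, by ring⟩
  have ho : ¬ Even (2 * j + 3) := by
    rw [Nat.not_even_iff_odd]; exact ⟨j + 1, by ring⟩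
  unfold registryTerm
  rw [if_pos he, if_neg ho]
  by_cases hecl : w (L + ε * (2 * j + 3 : ℕ)) = w L
  · -- eclipsed at odd separation ⇒ staggered at the even one before it
    have hstag : w (L + ε * (2 * j + 2 : ℕ)) ≠ w L := by
      rcases hε with rfl | rfl
      · refine hw.ne_of_eq_succ (s := 1 * (2 * j + 2 : ℕ)) ?_
        have : (1 : ℤ) * (2 * j + 2 : ℕ) + 1 = 1 * (2 * j + 3 : ℕ) := by push_cast; ring
        rw [this]; exact hecl
      · refine hw.ne_of_eq_pred (s := -1 * (2 * j + 2 : ℕ)) ?_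
        have : (-1 : ℤ) * (2 * j + 2 : ℕ) - 1 = -1 * (2 * j + 3 : ℕ) := by push_cast; ring
        rw [this]; exact hecl
    rw [if_neg hstag, if_pos hecl]
    by_cases hpos : 0 < b (2 * j + 3)
    · linarith [hodd hpos]
    · linarith
  · rw [if_neg hecl]
    split_ifs <;> linarith

/-- ★ **ONE-SIDED LAYER SURPLUS ≥ 0** under the table hypotheses (even entries `≥ 0`, positive odd entries dominated by their predecessors). -/
theorem wordSurplusSide_nonneg (hw : IsBarlowWord w) (L : ℤ) {ε : ℤ} (hε : ε = 1 ∨ ε = -1) (J : ℕ)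
    (heven : ∀ j < J, 0 ≤ b (2 * j + 2)) (hodd : ∀ j < J, 0 < b (2 * j + 3) → b (2 * j + 3) ≤ b (2 * j + 2)) :
    0 ≤ wordSurplusSide b w L ε J :=
  Finset.sum_nonneg fun j hj =>
    registryPair_nonneg hw L hε j (heven j (Finset.mem_range.1 hj)) (hodd j (Finset.mem_range.1 hj))

/-- ★★ **EVERY LAYER OF EVERY BARLOW WORD HAS NON-NEGATIVE SURPLUS OVER hcp** (memo g62 §1.3 (a)): both sides. -/
theorem wordSurplus_nonneg (hw : IsBarlowWord w) (L : ℤ) (J : ℕ)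
    (heven : ∀ j < J, 0 ≤ b (2 * j + 2)) (hodd : ∀ j < J, 0 < b (2 * j + 3) → b (2 * j + 3) ≤ b (2 * j + 2)) :
    0 ≤ wordSurplus b w L J :=
  add_nonneg (wordSurplusSide_nonneg hw L (Or.inl rfl) J heven hodd) (wordSurplusSide_nonneg hw L (Or.inr rfl) J heven hodd)

/-- The hcp word `…ABAB…`: letter `0` at even, `1` at odd positions. -/
def hcpWord (i : ℤ) : Fin 3 := if Even i then 0 else 1

/-- `hcpWord_isBarlowWord` (docstring added by the landing lane; see the module docstring). [formal bookkeeping] -/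
theorem hcpWord_isBarlowWord : IsBarlowWord hcpWord := by
  intro i
  unfold hcpWord
  by_cases hi : Even i
  · have : ¬ Even (i + 1) := Int.not_even_iff_odd.2 (Even.add_one hi)
    rw [if_pos hi, if_neg this]; decide
  · have : Even (i + 1) := by
      rw [Int.not_even_iff_odd] at hi; exact Odd.add_one hi
    rw [if_neg hi, if_pos this]; decide

/-- In the hcp word two layers carry the same letter iff their separation is even. -/
theorem hcpWord_eq_iff (L s : ℤ) : hcpWord (L + s) = hcpWord L ↔ Even s := by
  unfold hcpWord
  by_cases hL : Even L
  · by_cases hs : Even s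
    · have : Even (L + s) := hL.add hs
      simp only [if_pos this, if_pos hL, hs]
    · have : ¬ Even (L + s) := fun h => hs (by simpa using Int.even_sub.2 (iff_of_true h hL))
      simp only [if_neg this, if_pos hL, hs, iff_false]; decide
  · by_cases hs : Even s
    · have : ¬ Even (L + s) := fun h => hL (by simpa using Int.even_sub.2 (iff_of_true h hs))
      simp only [if_neg this, if_neg hL, hs]
    · have : Even (L + s) := by
        rw [Int.not_even_iff_odd] at hL hs; exact hL.add_odd hs
      simp only [if_pos this, if_neg hL, hs, iff_false]; decide

/-- Every registry term of the hcp word vanishes (eclipsed exactly at even separations). -/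
theorem registryTerm_hcpWord (b : ℕ → ℝ) (L : ℤ) {ε : ℤ} (hε : ε = 1 ∨ ε = -1) (k : ℕ) :
    registryTerm b hcpWord L (ε * k) k = 0 := by
  unfold registryTerm
  have hk : Even (ε * (k : ℤ)) ↔ Even k := by
    rcases hε with rfl | rfl <;> simp [Int.even_coe_nat]
  by_cases h : Even k
  · rw [if_pos h, if_pos ((hcpWord_eq_iff L _).2 (hk.2 h))]
  · rw [if_neg h, if_neg (fun h' => h (hk.1 ((hcpWord_eq_iff L _).1 h')))]

/-- ★ The hcp word has layer surplus exactly `0` (the minimum in `wordSurplus_nonneg`). -/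
theorem wordSurplus_hcp (b : ℕ → ℝ) (L : ℤ) (J : ℕ) : wordSurplus b hcpWord L J = 0 := by
  unfold wordSurplus wordSurplusSide
  simp only [registryTerm_hcpWord b L (Or.inl rfl), registryTerm_hcpWord b L (Or.inr rfl), add_zero,
    Finset.sum_const_zero]

/-- The fcc word `…ABCABC…`: letter `i mod 3`. -/
def fccWord (i : ℤ) : Fin 3 := ⟨(i % 3).toNat, by omega⟩

/-- `fccWord_isBarlowWord` (docstring added by the landing lane; see the module docstring). [formal bookkeeping] -/
theorem fccWord_isBarlowWord : IsBarlowWord fccWord := by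
  intro i h
  have h' := congrArg Fin.val h
  simp only [fccWord] at h'
  omega

/-- ★ RECORD PINS (census SEAM62.md §1, geometry of record, rationals enclosing the certified intervals): the three positive odd entries are
dominated by their even predecessors — `b₅ ≤ b₄`, `b₁₃ ≤ b₁₂`, `b₁₇ ≤ b₁₆` (upper bound of the odd one `<` lower bound of the even one). -/
theorem record_bk_dominance :
    (1247647361303190 : ℝ) / 10 ^ 23 < 1336319212497248 / 10 ^ 22 ∧
      (7252828091296011 : ℝ) / 10 ^ 23 < 1573541648301046 / 10 ^ 22 ∧
      (8092855794580514 : ℝ) / 10 ^ 24 < 1262883999805903 / 10 ^ 23 := by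
  norm_num

/-- RECORD READING (memo §1.2 row 0): the per-side second-neighbour constant `½ b₂` and the three basic layer surpluses `0, ½ b₂, b₂` enclose the
working figures `3.63·10⁻⁵ / 7.26·10⁻⁵`, and the dhcp excess per site `¼ (0 + ½b₂ + b₂ + ½b₂) = ½ b₂`. -/
theorem record_layer_surplus_reading :
    (7258953191552789 : ℝ) / 10 ^ 20 / 2 < 363 / 10 ^ 7 ∧ (3629 : ℝ) / 10 ^ 8 < 7258953191552789 / 10 ^ 20 / 2 ∧
      ((0 : ℝ) + 7258953191552789 / 10 ^ 20 / 2 + 7258953191552789 / 10 ^ 20 + 7258953191552789 / 10 ^ 20 / 2) / 4 =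
        7258953191552789 / 10 ^ 20 / 2 := by
  norm_num

end StackingWords

end Summit.AtomisticToContinuum.Crystallization.Theorems.ChargedEnergyGapChartDial
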